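import Mathlib
import HarnessLib
import Summits.QuantumFields.YangMills.Theorems.PencilRigidityWeakCouplingHypercubicLimitSignedPerm

/-!
# Crux `HypercubicLimit` (stmt-QuantumFields-16154), line `Sketch` (coupling response): time-reflection invariance of
the summed plane-string limits (stub `thetaOfPlaneLimits`)

Helper file for the skeleton `Cruxes/HypercubicLimit/Lines/Sketch.lean`.  Along a `PlaneLimits r sch φ T` package
with the `k`-uniform functional bound `UniformFunctionalBoundPlanes r sch` on `⁰𝒮`, the candidate one-field family
`planeSum T n = Σ_q T n q` is invariant under the Euclidean time reflection `Θ = thetaMulti 4` on every off-diagonal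
test function: `planeSum T n (ΘF) = planeSum T n F`.  This is the `Θ` half of the signed-permutation invariance of the
continuum limit (the `S₄` half is the neighbouring stub `coordPermOfPlaneLimits`; the lead glues the two halves via
`rpBlock_signedPermGeneration`).

The statement is derived from the twin crux's (`WeakCouplingHypercubicLimit`, stmt-QuantumFields-16120) landed r10
toolkit theorem `planeSum_thetaMulti`
(`Summits/QuantumFields/YangMills/Theorems/PencilRigidityWeakCouplingHypercubicLimitSignedPerm`), whose proof is the
lattice route: on the lattice the reflection is exact up to slot-wise one-step shifts of the base corners
(`planeDist_thetaMulti_eq`: `planeDist k n q (ΘF) = planeDist k n q (τ_{d_q} F)` for compactly supported `F` and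
large boxes, from the `Θ`-invariance of Wilson's odd-torus state under the bond reflection, `rpBlock_momentTheta`);
on the separated dense class the shifted test functions stay in `⁰𝒮` and tend to `F` in `𝓢`, so the
moving-test-function lemma `planeDist_tendsto_of_tendsto` identifies the two limits; general `F ∈ ⁰𝒮` by separated
density and continuity.  Nothing new is asserted here; this file only records the statement in the vocabulary and
binder order registered for the `HypercubicLimit` skeleton.

Refs: OsterwalderSchrader1973 §2 (Euclidean covariance on `⁰𝒮`); OsterwalderSeiler1978 §§2–3; Wilson1974
(hypercubic symmetry of the lattice action); GlimmJaffe1987 §6.1.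
-/

noncomputable section

open scoped SchwartzMap
open MeasureTheory Filter Topology Literature.MathematicalPhysics.AQFT Literature.MathematicalPhysics.QuantumLattice
  Literature.MathematicalPhysics.QuantumFieldTheory

namespace Summit.QuantumFields.YangMills.Cruxes.HypercubicLimit.CouplingResponse

/-- **Stub `thetaOfPlaneLimits` (line `Sketch`, coupling response): time-reflection invariance of the summed
plane-string limits on `⁰𝒮`.**  Along a `PlaneLimits r sch φ T` package (`φ` strictly monotone) with the `k`-uniform
functional bound `UniformFunctionalBoundPlanes r sch`, for every off-diagonal test function `F`:
`planeSum T n (thetaMulti 4 F) = planeSum T n F` — exact lattice reflection up to slot-wise one-unit shifts on the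
separated compactly supported class, then separated density (the twin toolkit's `planeSum_thetaMulti`). [folklore] -/
theorem thetaOfPlaneLimits : ∀ (G : Type) [Group G] [TopologicalSpace G] [IsTopologicalGroup G] [CompactSpace G] [MeasurableSpace G] [BorelSpace G] (r : LatticeRep G) (sch : SpeciesScheme (YMSpecies G)) (φ : ℕ → ℕ) (hφ : StrictMono φ) (T : (n : ℕ) → (Fin n → Plane) → (𝓢((Fin n → EuclideanSpace ℝ (Fin 4)), ℂ) →L[ℂ] ℂ)), UniformFunctionalBoundPlanes r sch → PlaneLimits r sch φ T → ∀ (n : ℕ) (F : 𝓢((Fin n → EuclideanSpace ℝ (Fin 4)), ℂ)), IsOffDiagonal F → planeSum T n (thetaMulti 4 F) = planeSum T n F := by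
  intro G _ _ _ _ _ _ r sch φ hφ T hUFB hPL n F hF
  exact Summit.QuantumFields.YangMills.Theorems.WeakCouplingHypercubicLimit.TraceNormColdPressure.planeSum_thetaMulti
    r sch φ hφ T hUFB hPL n F hF

end Summit.QuantumFields.YangMills.Cruxes.HypercubicLimit.CouplingResponse

end
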